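import Summits.FinalStateConjecture.FinalStateConjecture.Theorems.EIHFluxBalanceInertialRecessionStubRechart3ClockBounds

/-!
# Route EIHFluxBalance — `InertialRecession`, re-charting: the honest chart is C³-close to a Poincaré map

Helper file for the crux `stmt-FinalStateConjecture-10166`
(`Summit.FinalStateConjecture.FinalStateConjecture.Theses.EIHFluxBalance.InertialRecession`),
line `sublinear-is-free-clean-window-charges`, stub `stub_rechart` (the transfer P2), part G1.

On the rest-frame region `Q(τ₁, R) = {|y⁰ − τ₁| ≤ 1, ‖ỹ‖ ≤ R}` the honest chart
`ψ(y) = c(T y) + purgedFrame (Λ̃ (T y)) ỹ` satisfies, once the painted kinematics are `δ`-slow after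
the lab time `S` and `S + 4γR ≤ T₀(τ₁ − 1)`:
* `norm_iteratedFDeriv_two_honestChart_le`, `…_three_…` — `‖D²ψ‖ ≤ 78γ³(1+R)³δ`,
  `‖D³ψ‖ ≤ 472γ⁴(1+R)⁴δ`;
* `norm_fderiv_honestChart_centre_sub_le` — at the centre `(τ₁, 0)`: `‖Dψ − Λ̃(T₀ τ₁)‖ ≤ 5γδ`;
* `norm_fderiv_honestChart_sub_frame_le` — on `Q`: `‖Dψ(y) − Λ̃(T₀ τ₁)‖ ≤ 83γ³(1+R)⁴δ` (mean value
  theorem from the centre).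
So `ψ` is `C³`-close (in the seminorms of orders `1, 2, 3`) to the Poincaré map `y ↦ c(T₀τ₁) + Λ̃(T₀τ₁)(y − τ₁e₀)`
on `Q`, with constants polynomial in `γ, R` and linear in `δ`. [folklore]
-/

noncomputable section

set_option linter.dupNamespace false

open Set Filter Function Metric Topology
open scoped ContDiff
open Literature.Geometry.Lorentzian

namespace Summit.FinalStateConjecture.FinalStateConjecture.Theorems.SublinearIsFree.Rechart

/-- Monotonicity of the monomials `γ^a ρ^c δ` in the exponents (`γ, ρ ≥ 1`, `δ ≥ 0`). [folklore] -/
theorem monomial_mono {γ ρ δ : ℝ} (hγ : 1 ≤ γ) (hρ : 1 ≤ ρ) (hδ : 0 ≤ δ) {a b c d : ℕ} (hab : a ≤ b)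
    (hcd : c ≤ d) : γ ^ a * ρ ^ c * δ ≤ γ ^ b * ρ ^ d * δ :=
  mul_le_mul_of_nonneg_right (mul_le_mul (pow_le_pow_right₀ hγ hab) (pow_le_pow_right₀ hρ hcd)
    (by positivity) (by positivity)) hδ

section Bounds

variable (Λ : ℝ → lorentzGroup) (ξ : ℝ → E3) (T₀ : ℝ → ℝ)
  (hΛ : ContDiff ℝ ∞ (fun t ↦ ((Λ t : E4 ≃L[ℝ] E4) : E4 →L[ℝ] E4)))
  (hξ : ContDiff ℝ ∞ ξ) (hT₀ : ContDiff ℝ ∞ T₀)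
  (hclock : ∀ τ, HasDerivAt T₀ (frameVel (Λ (T₀ τ)) 0) τ)
  {γ : ℝ} (hγ1 : 1 ≤ γ) (hu1 : ∀ t, 1 ≤ frameVel (Λ t) 0)
  (huγ : ∀ t, |((Λ t : E4 ≃L[ℝ] E4) (E4.basisVector 0)) 0| ≤ γ)
  {S δ : ℝ} (hδ0 : 0 ≤ δ) (hδ1 : δ ≤ 1)
  (hu' : ∀ s, S ≤ s → ‖deriv (fun t ↦ frameVel (Λ t) 0) s‖ ≤ δ)
  (hu'' : ∀ s, S ≤ s → ‖iteratedDeriv 2 (fun t ↦ frameVel (Λ t) 0) s‖ ≤ δ)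
  (hL' : ∀ s, S ≤ s → ‖deriv (fun t ↦ frameTilt (Λ t)) s‖ ≤ δ)
  (hL'' : ∀ s, S ≤ s → ‖iteratedDeriv 2 (fun t ↦ frameTilt (Λ t)) s‖ ≤ δ)
  (hL''' : ∀ s, S ≤ s → ‖iteratedDeriv 3 (fun t ↦ frameTilt (Λ t)) s‖ ≤ δ)
  (hP' : ∀ s, S ≤ s → ‖deriv (fun t ↦ purgedFrame (Λ t)) s‖ ≤ δ)
  (hP'' : ∀ s, S ≤ s → ‖iteratedDeriv 2 (fun t ↦ purgedFrame (Λ t)) s‖ ≤ δ)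
  (hP''' : ∀ s, S ≤ s → ‖iteratedDeriv 3 (fun t ↦ purgedFrame (Λ t)) s‖ ≤ δ)
  (hc' : ∀ s, S ≤ s → ‖deriv (centrePath ξ) s - normVel (Λ s)‖ ≤ δ)
  (hc'' : ∀ s, S ≤ s → ‖iteratedDeriv 2 (centrePath ξ) s‖ ≤ δ)
  (hc''' : ∀ s, S ≤ s → ‖iteratedDeriv 3 (centrePath ξ) s‖ ≤ δ)

include huγ in
/-- `‖Λ̃ t‖ ≤ 4γ`. [folklore] -/
theorem norm_frame_le_four_mul (t : ℝ) : ‖((Λ t : E4 ≃L[ℝ] E4) : E4 →L[ℝ] E4)‖ ≤ 4 * γ :=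
  (norm_lorentz_le (Λ t)).trans (by linarith [huγ t, one_le_abs_lorentz_apply_zero (Λ t)])

include huγ in
/-- The lab time of the chart point differs from the clock by at most `4γ‖ỹ‖`. [folklore] -/
theorem abs_clockMap_sub_le (y : E4) : |clockMap Λ T₀ y - T₀ (y 0)| ≤ 4 * γ * ‖E4.spatial y‖ := by
  rw [clockMap, add_sub_cancel_left, ← Real.norm_eq_abs]
  refine ((frameTilt (Λ (T₀ (y 0)))).le_opNorm _).trans ?_
  exact mul_le_mul_of_nonneg_right ((norm_frameTilt_le _).trans (norm_frame_le_four_mul Λ huγ _))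
    (norm_nonneg _)

include huγ hδ1 hc' in
/-- `‖c'(s)‖ ≤ 5γ` after `S`. [folklore] -/
theorem norm_deriv_centrePath_le {s : ℝ} (hs : S ≤ s) (hγ1 : 1 ≤ γ) : ‖deriv (centrePath ξ) s‖ ≤ 5 * γ := by
  have h1 := hc' s hs
  have h2 : ‖normVel (Λ s)‖ ≤ 4 * γ := (norm_normVel_le _).trans (norm_frame_le_four_mul Λ huγ s)
  have h3 : ‖deriv (centrePath ξ) s‖ ≤ ‖deriv (centrePath ξ) s - normVel (Λ s)‖ + ‖normVel (Λ s)‖ :=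
    norm_le_norm_sub_add _ _
  linarith

include hΛ hξ hT₀ hclock hγ1 hu1 huγ hδ0 hδ1 hu' hu'' hL' hL'' hL''' hP' hP'' hP''' hc' hc'' hc''' in
-- long chain of explicit bounds
set_option maxHeartbeats 400000 in
/-- **Second and third derivatives of the honest chart.** For `‖ỹ‖ ≤ R` and `S + 4γR ≤ T₀ y⁰`:
`‖D²ψ(y)‖ ≤ 78γ³(1+R)³δ` and `‖D³ψ(y)‖ ≤ 472γ⁴(1+R)⁴δ`. [folklore] -/
theorem norm_iteratedFDeriv_honestChart_le {R : ℝ} (hR : 0 ≤ R) {y : E4} (hy : ‖E4.spatial y‖ ≤ R)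
    (hS : S + 4 * γ * R ≤ T₀ (y 0)) :
    ‖iteratedFDeriv ℝ 2 (honestChart Λ ξ T₀) y‖ ≤ 78 * γ ^ 3 * (1 + R) ^ 3 * δ ∧
      ‖iteratedFDeriv ℝ 3 (honestChart Λ ξ T₀) y‖ ≤ 472 * γ ^ 4 * (1 + R) ^ 4 * δ := by
  set ρ : ℝ := 1 + R with hρ
  have hρ1 : 1 ≤ ρ := by rw [hρ]; linarith
  have hγ0 : 0 ≤ γ := by linarith
  have hγR : 0 ≤ 4 * γ * R := by positivity
  have hS0 : S ≤ T₀ (y 0) := by linarith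
  -- the lab time of the chart point is after `S`
  have hT : S ≤ clockMap Λ T₀ y := by
    have h := abs_clockMap_sub_le Λ T₀ huγ y
    have h2 : 4 * γ * ‖E4.spatial y‖ ≤ 4 * γ * R := mul_le_mul_of_nonneg_left hy (by positivity)
    linarith [neg_abs_le (clockMap Λ T₀ y - T₀ (y 0))]
  -- clock map bounds
  obtain ⟨d1, d2, d3⟩ := norm_iteratedFDeriv_clockMap_le Λ T₀ hΛ hT₀ hclock hγ1 hu1 huγ hδ0 hδ1 hu' hu''
    hL' hL'' hL''' hR hy hS0
  set T := clockMap Λ T₀ with hTdef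
  have hTs : ContDiff ℝ ∞ T := contDiff_clockMap Λ T₀ hΛ hT₀
  have hT3 : ContDiff ℝ 3 T := hTs.of_le (WithTop.coe_le_coe.mpr le_top)
  -- the two parts
  have hcs : ContDiff ℝ ∞ (centrePath ξ) := contDiff_centrePath hξ
  have hPs : ContDiff ℝ ∞ (fun t ↦ purgedFrame (Λ t)) := contDiff_purgedFrame Λ hΛ
  set PT : E4 → E3 →L[ℝ] E4 := fun y ↦ purgedFrame (Λ (T y)) with hPT
  have hPTs : ContDiff ℝ 3 PT := (hPs.comp hTs).of_le (WithTop.coe_le_coe.mpr le_top)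
  have hfun : honestChart Λ ξ T₀ = fun y ↦ centrePath ξ (T y) + PT y (E4.spatial y) := rfl
  -- one-variable bounds at the lab time `T y`
  have a1 : ‖deriv (centrePath ξ) (T y)‖ ≤ 5 * γ := norm_deriv_centrePath_le Λ ξ huγ hδ1 hc' hT hγ1
  have a2 := hc'' _ hT
  have a3 := hc''' _ hT
  -- chain rules for `c ∘ T`
  have hc2 := norm_iteratedFDeriv_two_comp_scalar_le (hcs.of_le (WithTop.coe_le_coe.mpr le_top))
    (hTs.of_le (WithTop.coe_le_coe.mpr le_top)) y a1 a2 d1 d2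
  have hc3 := norm_iteratedFDeriv_three_comp_scalar_le (hcs.of_le (WithTop.coe_le_coe.mpr le_top))
    hT3 y a1 a2 a3 d1 d2 d3
  -- chain rules for `P ∘ T`
  have hq1 := norm_iteratedFDeriv_one_comp_scalar_le (hPs.differentiable (by simp))
    (hTs.differentiable (by simp)) y (hP' _ hT) d1
  have hq2 := norm_iteratedFDeriv_two_comp_scalar_le (hPs.of_le (WithTop.coe_le_coe.mpr le_top))
    (hTs.of_le (WithTop.coe_le_coe.mpr le_top)) y (hP' _ hT) (hP'' _ hT) d1 d2
  have hq3 := norm_iteratedFDeriv_three_comp_scalar_le (hPs.of_le (WithTop.coe_le_coe.mpr le_top))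
    hT3 y (hP' _ hT) (hP'' _ hT) (hP''' _ hT) d1 d2 d3
  -- Leibniz for `PT ỹ`
  obtain ⟨-, hl2, hl3⟩ := norm_iteratedFDeriv_apply_spatial_le hPTs y
  -- sum rule
  have hA' : ContDiff ℝ ∞ (fun y ↦ centrePath ξ (T y)) := hcs.comp hTs
  have hB' : ContDiff ℝ ∞ (fun y ↦ PT y (E4.spatial y)) := (hPs.comp hTs).clm_apply E4.spatial.contDiff
  have hadd : ∀ k : ℕ, iteratedFDeriv ℝ k (honestChart Λ ξ T₀) y =
      iteratedFDeriv ℝ k (fun y ↦ centrePath ξ (T y)) y +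
        iteratedFDeriv ℝ k (fun y ↦ PT y (E4.spatial y)) y := fun k ↦ by
    rw [hfun]
    exact iteratedFDeriv_add_apply (hA'.of_le (WithTop.coe_le_coe.mpr le_top)).contDiffAt
      (hB'.of_le (WithTop.coe_le_coe.mpr le_top)).contDiffAt
  -- monomial bookkeeping (`γ, ρ ≥ 1`, `0 ≤ δ ≤ 1`)
  have m := fun (a b c d : ℕ) (hab : a ≤ b) (hcd : c ≤ d) ↦ monomial_mono hγ1 hρ1 hδ0 hab hcd
  have hδδ : δ * δ ≤ δ := by nlinarith
  -- `‖D² (c∘T)‖ ≤ 40 γ³ρ²δ`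
  have e1 : ‖iteratedFDeriv ℝ 2 (fun y ↦ centrePath ξ (T y)) y‖ ≤ 40 * γ ^ 3 * ρ ^ 2 * δ := by
    have h1 : δ * (5 * γ * (1 + R)) ^ 2 = 25 * (γ ^ 2 * ρ ^ 2 * δ) := by rw [hρ]; ring
    have h2 : 5 * γ * (3 * γ ^ 2 * (1 + R) * δ) = 15 * (γ ^ 3 * ρ ^ 1 * δ) := by rw [hρ]; ring
    have := m 2 3 2 2 (by norm_num) le_rfl
    have := m 3 3 1 2 le_rfl (by norm_num)
    linarith [hc2]
  -- `‖D³ (c∘T)‖ ≤ 210 γ⁴ρ³δ`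
  have e2 : ‖iteratedFDeriv ℝ 3 (fun y ↦ centrePath ξ (T y)) y‖ ≤ 210 * γ ^ 4 * ρ ^ 3 * δ := by
    have h1 : δ * (5 * γ * (1 + R)) ^ 3 = 125 * (γ ^ 3 * ρ ^ 3 * δ) := by rw [hρ]; ring
    have h2 : 3 * δ * (5 * γ * (1 + R)) * (3 * γ ^ 2 * (1 + R) * δ) = 45 * (γ ^ 3 * ρ ^ 2 * δ) * δ := by
      rw [hρ]; ring
    have h3 : 5 * γ * (8 * γ ^ 3 * (1 + R) * δ) = 40 * (γ ^ 4 * ρ ^ 1 * δ) := by rw [hρ]; ring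
    have := m 3 4 3 3 (by norm_num) le_rfl
    have := m 3 4 2 3 (by norm_num) (by norm_num)
    have := m 4 4 1 3 le_rfl (by norm_num)
    have h4 : (γ ^ 3 * ρ ^ 2 * δ) * δ ≤ γ ^ 3 * ρ ^ 2 * δ :=
      mul_le_of_le_one_right (by positivity) hδ1
    linarith [hc3]
  -- `‖D¹ (P∘T)‖ ≤ 5γρδ`, `‖D² (P∘T)‖ ≤ 28 γ²ρ²δ`, `‖D³ (P∘T)‖ ≤ 178 γ³ρ³δ`
  have f1 : ‖iteratedFDeriv ℝ 1 PT y‖ ≤ 5 * (γ ^ 1 * ρ ^ 1 * δ) := by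
    have h1 : δ * (5 * γ * (1 + R)) = 5 * (γ ^ 1 * ρ ^ 1 * δ) := by rw [hρ]; ring
    linarith [hq1]
  have f2 : ‖iteratedFDeriv ℝ 2 PT y‖ ≤ 28 * (γ ^ 2 * ρ ^ 2 * δ) := by
    have h1 : δ * (5 * γ * (1 + R)) ^ 2 = 25 * (γ ^ 2 * ρ ^ 2 * δ) := by rw [hρ]; ring
    have h2 : δ * (3 * γ ^ 2 * (1 + R) * δ) = 3 * (γ ^ 2 * ρ ^ 1 * δ) * δ := by rw [hρ]; ring
    have := m 2 2 1 2 le_rfl (by norm_num)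
    have h4 : (γ ^ 2 * ρ ^ 1 * δ) * δ ≤ γ ^ 2 * ρ ^ 1 * δ := mul_le_of_le_one_right (by positivity) hδ1
    linarith [hq2]
  have f3 : ‖iteratedFDeriv ℝ 3 PT y‖ ≤ 178 * (γ ^ 3 * ρ ^ 3 * δ) := by
    have h1 : δ * (5 * γ * (1 + R)) ^ 3 = 125 * (γ ^ 3 * ρ ^ 3 * δ) := by rw [hρ]; ring
    have h2 : 3 * δ * (5 * γ * (1 + R)) * (3 * γ ^ 2 * (1 + R) * δ) = 45 * (γ ^ 3 * ρ ^ 2 * δ) * δ := by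
      rw [hρ]; ring
    have h3 : δ * (8 * γ ^ 3 * (1 + R) * δ) = 8 * (γ ^ 3 * ρ ^ 1 * δ) * δ := by rw [hρ]; ring
    have := m 3 3 2 3 le_rfl (by norm_num)
    have := m 3 3 1 3 le_rfl (by norm_num)
    have h4 : (γ ^ 3 * ρ ^ 2 * δ) * δ ≤ γ ^ 3 * ρ ^ 2 * δ := mul_le_of_le_one_right (by positivity) hδ1
    have h5 : (γ ^ 3 * ρ ^ 1 * δ) * δ ≤ γ ^ 3 * ρ ^ 1 * δ := mul_le_of_le_one_right (by positivity) hδ1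
    linarith [hq3]
  -- Leibniz: `‖D² (PT ỹ)‖ ≤ 38 γ²ρ³δ`, `‖D³ (PT ỹ)‖ ≤ 262 γ³ρ⁴δ`
  have hRρ : R ≤ ρ := by rw [hρ]; linarith
  have g2 : ‖iteratedFDeriv ℝ 2 (fun y ↦ PT y (E4.spatial y)) y‖ ≤ 38 * γ ^ 2 * ρ ^ 3 * δ := by
    have h1 : ‖iteratedFDeriv ℝ 2 PT y‖ * ‖E4.spatial y‖ ≤ 28 * (γ ^ 2 * ρ ^ 2 * δ) * ρ :=
      mul_le_mul f2 (hy.trans hRρ) (norm_nonneg _) (by positivity)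
    have h2 : 28 * (γ ^ 2 * ρ ^ 2 * δ) * ρ = 28 * (γ ^ 2 * ρ ^ 3 * δ) := by ring
    have := m 1 2 1 3 (by norm_num) (by norm_num)
    linarith [hl2, f1]
  have g3 : ‖iteratedFDeriv ℝ 3 (fun y ↦ PT y (E4.spatial y)) y‖ ≤ 262 * γ ^ 3 * ρ ^ 4 * δ := by
    have h1 : ‖iteratedFDeriv ℝ 3 PT y‖ * ‖E4.spatial y‖ ≤ 178 * (γ ^ 3 * ρ ^ 3 * δ) * ρ :=
      mul_le_mul f3 (hy.trans hRρ) (norm_nonneg _) (by positivity)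
    have h2 : 178 * (γ ^ 3 * ρ ^ 3 * δ) * ρ = 178 * (γ ^ 3 * ρ ^ 4 * δ) := by ring
    have := m 2 3 2 4 (by norm_num) (by norm_num)
    linarith [hl3, f2]
  -- assemble
  refine ⟨?_, ?_⟩
  · rw [hadd 2]
    refine (norm_add_le _ _).trans ?_
    have := m 3 3 2 3 le_rfl (by norm_num)
    have := m 2 3 3 3 (by norm_num) le_rfl
    have h : 78 * γ ^ 3 * (1 + R) ^ 3 * δ = 78 * (γ ^ 3 * ρ ^ 3 * δ) := by rw [hρ]; ring
    linarith [e1, g2]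
  · rw [hadd 3]
    refine (norm_add_le _ _).trans ?_
    have := m 4 4 3 4 le_rfl (by norm_num)
    have := m 3 4 4 4 (by norm_num) le_rfl
    have h : 472 * γ ^ 4 * (1 + R) ^ 4 * δ = 472 * (γ ^ 4 * ρ ^ 4 * δ) := by rw [hρ]; ring
    linarith [e2, g3]

include hΛ hξ hT₀ hclock huγ hc' in
/-- **The centre estimate**: at a point `y₁` of the centre line (`ỹ₁ = 0`) with `S ≤ T₀ y₁⁰`,
`‖Dψ(y₁) − Λ̃(T₀ y₁⁰)‖ ≤ 5γδ`. [folklore] -/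
theorem norm_fderiv_honestChart_centre_sub_le {y₁ : E4} (hy₁ : E4.spatial y₁ = 0) (hS : S ≤ T₀ (y₁ 0)) :
    ‖fderiv ℝ (honestChart Λ ξ T₀) y₁ - ((Λ (T₀ (y₁ 0)) : E4 ≃L[ℝ] E4) : E4 →L[ℝ] E4)‖ ≤ 5 * γ * δ := by
  have hγ0 : 0 ≤ γ := (abs_nonneg _).trans (huγ 0)
  have hδ0 : 0 ≤ δ := (norm_nonneg _).trans (hc' _ hS)
  refine ContinuousLinearMap.opNorm_le_bound _ (by positivity) fun v ↦ ?_
  rw [sub_apply, ContinuousLinearEquiv.coe_coe,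
    fderiv_honestChart_centre_sub Λ ξ T₀ hΛ hξ hT₀ hy₁ (hclock _).deriv v, norm_smul]
  have h1 : ‖deriv T₀ (y₁ 0) * v 0 + frameTilt (Λ (T₀ (y₁ 0))) (E4.spatial v)‖ ≤ 5 * γ * ‖v‖ := by
    rw [(hclock _).deriv]
    refine (norm_add_le _ _).trans ?_
    have e1 : ‖frameVel (Λ (T₀ (y₁ 0))) 0 * v 0‖ ≤ γ * ‖v‖ := by
      rw [norm_mul]
      refine mul_le_mul ?_ ?_ (norm_nonneg _) hγ0
      · simpa [frameVel] using huγ (T₀ (y₁ 0))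
      · simpa using PiLp.norm_apply_le v 0
    have e2 : ‖frameTilt (Λ (T₀ (y₁ 0))) (E4.spatial v)‖ ≤ 4 * γ * ‖v‖ := by
      refine ((frameTilt _).le_opNorm _).trans ?_
      refine mul_le_mul ((norm_frameTilt_le _).trans (norm_frame_le_four_mul Λ huγ _)) ?_
        (norm_nonneg _) (by positivity)
      simpa using E4.spatial.le_opNorm v |>.trans
        (mul_le_of_le_one_left (norm_nonneg _) norm_spatialCLM_le)
    linarith
  have h2 := hc' _ hS
  calc ‖deriv T₀ (y₁ 0) * v 0 + frameTilt (Λ (T₀ (y₁ 0))) (E4.spatial v)‖ *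
        ‖deriv (centrePath ξ) (T₀ (y₁ 0)) - normVel (Λ (T₀ (y₁ 0)))‖
      ≤ 5 * γ * ‖v‖ * δ := mul_le_mul h1 h2 (norm_nonneg _) (by positivity)
    _ = 5 * γ * δ * ‖v‖ := by ring

include hΛ hξ hT₀ hclock hγ1 hu1 huγ hδ0 hδ1 hu' hu'' hL' hL'' hL''' hP' hP'' hP''' hc' hc'' hc''' in
/-- **The honest chart is C¹-close to the frozen frame on the whole region** `Q(τ₁, R)`: for
`|y⁰ − τ₁| ≤ 1`, `‖ỹ‖ ≤ R`, a monotone clock and `S + 4γR ≤ T₀(τ₁ − 1)`,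
`‖Dψ(y) − Λ̃(T₀ τ₁)‖ ≤ 83γ³(1+R)⁴δ` (mean value theorem from the centre `(τ₁, 0)` with the bound on
`D²ψ`, plus the centre estimate). [folklore] -/
theorem norm_fderiv_honestChart_sub_frame_le {R τ₁ : ℝ} (hR : 0 ≤ R) (hmono : Monotone T₀)
    (hS : S + 4 * γ * R ≤ T₀ (τ₁ - 1)) {y : E4} (hy0 : |y 0 - τ₁| ≤ 1) (hy : ‖E4.spatial y‖ ≤ R) :
    ‖fderiv ℝ (honestChart Λ ξ T₀) y - ((Λ (T₀ τ₁) : E4 ≃L[ℝ] E4) : E4 →L[ℝ] E4)‖ ≤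
      83 * γ ^ 3 * (1 + R) ^ 4 * δ := by
  set ρ : ℝ := 1 + R with hρ
  have hρ1 : 1 ≤ ρ := by rw [hρ]; linarith
  have hγ0 : 0 ≤ γ := by linarith
  -- the region and its centre
  set Q : Set E4 := {z | z 0 ∈ Icc (τ₁ - 1) (τ₁ + 1)} ∩ {z | E4.spatial z ∈ closedBall (0 : E3) R} with hQ
  have hQc : Convex ℝ Q :=
    ((convex_Icc _ _).linear_preimage ((EuclideanSpace.proj (0 : Fin 4) : E4 →L[ℝ] ℝ) : E4 →ₗ[ℝ] ℝ)).inter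
      ((convex_closedBall _ _).linear_preimage (E4.spatial : E4 →ₗ[ℝ] E3))
  set y₁ : E4 := E4.ofTimeSpace τ₁ 0 with hy₁
  have hy₁0 : y₁ 0 = τ₁ := E4.ofTimeSpace_apply_zero _ _
  have hy₁s : E4.spatial y₁ = 0 := E4.spatial_ofTimeSpace _ _
  have hmemQ : ∀ z : E4, |z 0 - τ₁| ≤ 1 → ‖E4.spatial z‖ ≤ R → z ∈ Q := fun z hz0 hz ↦ by
    refine ⟨?_, by simpa using hz⟩
    show z 0 ∈ Icc (τ₁ - 1) (τ₁ + 1)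
    rw [abs_sub_le_iff] at hz0
    exact ⟨by linarith, by linarith⟩
  have hyQ : y ∈ Q := hmemQ y hy0 hy
  have hy₁Q : y₁ ∈ Q := hmemQ y₁ (by rw [hy₁0, sub_self, abs_zero]; exact zero_le_one)
    (by rw [hy₁s, norm_zero]; exact hR)
  -- every point of `Q` is late enough
  have hlate : ∀ z ∈ Q, S + 4 * γ * R ≤ T₀ (z 0) := fun z hz ↦
    hS.trans (hmono (show τ₁ - 1 ≤ z 0 from hz.1.1))
  -- the bound on `D²ψ` on `Q`
  have hψ : ContDiff ℝ ∞ (honestChart Λ ξ T₀) := contDiff_honestChart Λ ξ T₀ hΛ hξ hT₀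
  have hbound : ∀ z ∈ Q, ‖fderiv ℝ (fderiv ℝ (honestChart Λ ξ T₀)) z‖ ≤ 78 * γ ^ 3 * ρ ^ 3 * δ := by
    intro z hz
    have hz' : ‖E4.spatial z‖ ≤ R := by simpa using hz.2
    have h := (norm_iteratedFDeriv_honestChart_le Λ ξ T₀ hΛ hξ hT₀ hclock hγ1 hu1 huγ hδ0 hδ1 hu' hu''
      hL' hL'' hL''' hP' hP'' hP''' hc' hc'' hc''' hR hz' (hlate z hz)).1
    rw [← norm_iteratedFDeriv_zero (𝕜 := ℝ) (f := fderiv ℝ (fderiv ℝ (honestChart Λ ξ T₀))),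
      norm_iteratedFDeriv_fderiv, norm_iteratedFDeriv_fderiv]
    simpa [hρ] using h
  have hdiff : ∀ z ∈ Q, DifferentiableAt ℝ (fderiv ℝ (honestChart Λ ξ T₀)) z := fun z _ ↦
    ((hψ.fderiv_right (m := 1) (WithTop.coe_le_coe.mpr le_top)).differentiable (by simp)) z
  -- mean value theorem from the centre
  have hmvt := hQc.norm_image_sub_le_of_norm_fderiv_le hdiff hbound hy₁Q hyQ
  have hdist : ‖y - y₁‖ ≤ ρ := by
    have h := norm_sq_eq_sq_add_spatialNorm_sq (y - y₁)
    have h0 : (y - y₁) 0 = y 0 - τ₁ := by rw [PiLp.sub_apply, hy₁0]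
    have hs : E4.spatialNorm (y - y₁) = ‖E4.spatial y‖ := by
      show ‖E4.spatial (y - y₁)‖ = ‖E4.spatial y‖
      rw [map_sub, hy₁s, sub_zero]
    rw [h0, hs] at h
    have h1 : (y 0 - τ₁) ^ 2 ≤ 1 := by
      have := abs_le.mp hy0
      nlinarith
    have h2 : ‖E4.spatial y‖ ^ 2 ≤ R ^ 2 := pow_le_pow_left₀ (norm_nonneg _) hy 2
    have h3 : ‖y - y₁‖ ^ 2 ≤ ρ ^ 2 := by rw [h, hρ]; nlinarith
    exact le_of_pow_le_pow_left₀ two_ne_zero (by positivity) h3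
  -- the centre estimate
  have hcen := norm_fderiv_honestChart_centre_sub_le Λ ξ T₀ hΛ hξ hT₀ hclock huγ hc' hy₁s
    (by rw [hy₁0]; linarith [hS, hmono (show τ₁ - 1 ≤ τ₁ by linarith), mul_nonneg (mul_nonneg (by norm_num : (0:ℝ) ≤ 4) hγ0) hR])
  rw [hy₁0] at hcen
  -- assemble
  have htri : ‖fderiv ℝ (honestChart Λ ξ T₀) y - ((Λ (T₀ τ₁) : E4 ≃L[ℝ] E4) : E4 →L[ℝ] E4)‖ ≤
      ‖fderiv ℝ (honestChart Λ ξ T₀) y - fderiv ℝ (honestChart Λ ξ T₀) y₁‖ +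
        ‖fderiv ℝ (honestChart Λ ξ T₀) y₁ - ((Λ (T₀ τ₁) : E4 ≃L[ℝ] E4) : E4 →L[ℝ] E4)‖ :=
    norm_sub_le_norm_sub_add_norm_sub _ _ _
  have e1 : ‖fderiv ℝ (honestChart Λ ξ T₀) y - fderiv ℝ (honestChart Λ ξ T₀) y₁‖ ≤
      78 * γ ^ 3 * ρ ^ 3 * δ * ρ := hmvt.trans (mul_le_mul_of_nonneg_left hdist (by positivity))
  have e2 : γ * δ ≤ γ ^ 3 * ρ ^ 4 * δ := by
    have := monomial_mono hγ1 hρ1 hδ0 (show 1 ≤ 3 by norm_num) (show 0 ≤ 4 by norm_num)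
    simpa using this
  have e3 : 78 * γ ^ 3 * ρ ^ 3 * δ * ρ = 78 * (γ ^ 3 * ρ ^ 4 * δ) := by ring
  have e4 : 83 * γ ^ 3 * (1 + R) ^ 4 * δ = 83 * (γ ^ 3 * ρ ^ 4 * δ) := by rw [hρ]; ring
  linarith

end Bounds

/-- Registered one-line form (worker carrier `rechart_monomial_mono`). [folklore] -/
theorem rechart_monomial_mono : ∀ {γ ρ δ : ℝ}, 1 ≤ γ → 1 ≤ ρ → 0 ≤ δ → ∀ {a b c d : ℕ}, a ≤ b → c ≤ d → γ ^ a * ρ ^ c * δ ≤ γ ^ b * ρ ^ d * δ := fun hγ hρ hδ _ _ _ _ hab hcd ↦ monomial_mono hγ hρ hδ hab hcd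

end Summit.FinalStateConjecture.FinalStateConjecture.Theorems.SublinearIsFree.Rechart

end
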